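import Mathlib.RingTheory.PowerSeries.Basic
import Mathlib.Algebra.Order.BigOperators.Group.Finset
import Mathlib.Data.Nat.Choose.Sum
import Mathlib.Analysis.SpecialFunctions.Pow.Real
import HarnessLib

/-!
# Graham's Borel-type bound for `z_c(d)` (BDGS 2012, (1.20)), I: the reversion coefficients `αₙ`
# and the factorial bound `|αₙ| ≤ C₂ⁿ n!` (Graham 2010, Lemmas 2–3)

Sibling file of `Literature.Probability.RandomPlanarGeometry.BDGS2012` (namespace
`Literature.Probability.RandomPlanarGeometry.SAW.Zd`), first step of the discharge of the named fact
`BDGS2012_Graham_criticalPoint_bound` = Graham 2010, Theorem 1: "there exist a constant `C₁` such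
that for all `d`, `|β_c(s) - Σ_{n=1}^{M-1} αₙ sⁿ| ≤ C₁^M s^M M!`, `M = 1, 2, …`" (`s = 1/(2d)`,
`β_c = 1/μ(d) = z_c(d)`). This file is the purely algebraic layer of Graham's §3–§4: the
coefficients `αₙ` of the formal `1/(2d)`-expansion as functions of the lace-graph coefficients
`c_{a,b}`, and the factorial bound of Lemma 3 deduced from the bound of Lemma 4. Nothing here
refers to walks; the coefficients `c : ℕ → ℕ → ℝ` are arbitrary (in the sequel they are the
`c_{a,b} = Σ_N (-1)^{N+1} c_{a,b,N}` of Graham's (cab)).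

## What the source prints (B. T. Graham, J. Phys. A 43 (2010) 235001 = arXiv:0911.5163, §3–§4)

* §3: "Let `I = {(a,b) : b = 1,2,…; a = b+1,…,2b}` … Using this notation to rewrite (identity)
  yields a formal power series `β_τ = s[1 + Σ_{(a,b)∈I} β_τ^a c_{a,b} s^{b-a}]` … iterating in this
  way yields a series expansion for `β_τ`: `β_τ = s + c_{2,1}s² + (2c_{2,1}² + c_{3,2} + c_{4,2})s³ + …`
  The coefficient `αₙ` of `sⁿ` in `β_τ` is thus a multinomial function of the `c_{a,b}`."
  **Lemma 2** gives the closed (Lagrange–Bürmann) formula for `αₙ`; its proof begins "Let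
  `φ(β) = 1 + Σ_I c_{a,b} β^a s^{b-a}`. Setting `β = Σ αₙ sⁿ`, (the fixed-point display above) becomes
  `β/φ(β) = s`."
* **Lemma 3.** "There is a constant `C₂` such that for all `n`, `|αₙ| ≤ C₂ⁿ n!`" — "achieved by
  bounding `|c_{a,b}|` in terms of `b`": **Lemma 4.** "Let `c_b = Σ_{a=b+1}^{2b} |c_{a,b}|`. There is
  a constant `C₃` such that `c_b ≤ C₃^b b!`"; and **Lemma 5 / Corollary 6** (powers of the factorial
  series: `[β^k](Σ_{k≥1} k! β^k)^n ≤ 6^k (k-n)!`).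

## What is formalised (namespace `Literature.Probability.RandomPlanarGeometry.SAW.Zd.Graham2010`)

Writing `β = s·U(s)`, the fixed-point equation `β = s φ(β)` is `U = 1 + Σ_{b≥1} s^b Σ_{a=b+1}^{2b}
c_{a,b} U^a`, a triangular recursion for the coefficients of `U` (the `s^b`, `b ≥ 1`, make
`[sⁿ]U` depend on `[s^{<n}]U` only); `αₙ = [s^{n-1}] U`.
* `cpow f a m = [s^m] (Σᵢ fᵢ sⁱ)^a` (convolution powers of a coefficient sequence, by the explicit
  recursion; `cpow_eq_coeff_pow` identifies it with Mathlib's `PowerSeries.coeff m ((mk f)^a)`),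
  with locality, monotonicity and the binomial formula `cpow_one_add`;
* `coefU c n = [sⁿ] U` and **`alpha c n = αₙ`** (`alpha c 0 = 0`), with the defining recursion
  `coefU_succ` and the first values `alpha_one : α₁ = 1`, `alpha_two : α₂ = c_{2,1}`,
  `alpha_three : α₃ = 2c_{2,1}² + c_{3,2} + c_{4,2}` — Graham's displayed expansion;
* the factorial toolkit replacing Lemma 5 / Corollary 6: `factorial_mul_factorial_le`
  (`i!(m-i)! ≤ (m-1)!` for `1 ≤ i ≤ m-1`) and **`cpow_le_of_factorial_bound`**: if `f₀ = 0` and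
  `0 ≤ f_l ≤ A B^l l!` (`1 ≤ l ≤ M`) then `[s^m] f^j ≤ A^j B^m m!` for `j ≥ 1`, `m ≤ M` (for series
  without constant term the printed `6ⁿ` is not needed);
* **Lemma 3 from Lemma 4**, PROVED: `abs_alpha_le_of_lemma4` — if `Σ_{a=b+1}^{2b} |c_{a,b}| ≤ C^b b!`
  for all `b ≥ 1` then `|αₙ| ≤ (max 1 (16C))ⁿ n!` for all `n` — and the printed form
  `lemma3_of_lemma4 : … → ∃ C₂, ∀ n, |αₙ| ≤ C₂ⁿ n!`.

The proof of Lemma 3 here is NOT Graham's (Lagrange–Bürmann formula + Lemma 5): it is a direct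
majorant induction on the triangular recursion (`Ũ` with `|c_{a,b}|` dominates `U`
coefficientwise; with `V = Ũ - 1`, `[s^m]V^j ≤ B^m m!` by `cpow_le_of_factorial_bound`, whence
`ũₙ₊₁ ≤ C^{n+1}(n+1)! + Σ_{b=1}^{n} (4C)^b B^{n+1-b} b!(n+1-b)! ≤ B^{n+1}(n+1)!` for `B ≥ 16C`,
`B ≥ 1`). Not here: the lace-graph coefficients `c_{a,b,N}` themselves, Lemma 4, Lemma 7 and §6
(the sequel files of this discharge).
-/

noncomputable section

open Finset
open scoped BigOperators

namespace Literature.Probability.RandomPlanarGeometry.SAW.Zd.Graham2010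

/-! ### Convolution powers of a coefficient sequence -/

/-- `cpow f a m = [s^m] (Σᵢ fᵢ sⁱ)^a`, the `m`-th coefficient of the `a`-th power of the formal
power series with coefficients `f`, by the recursion `[s^m] F^{a+1} = Σ_{k ≤ m} [s^k]F^a · f_{m-k}`
(see `cpow_eq_coeff_pow`); Graham's notation is "`[βⁿ]φ(β)` denotes the coefficient of `βⁿ`".
[cite: Graham2010, Section 3, proof of Lemma 2] -/
def cpow (f : ℕ → ℝ) : ℕ → ℕ → ℝ
  | 0, m => if m = 0 then 1 else 0
  | a + 1, m => ∑ k ∈ range (m + 1), cpow f a k * f (m - k)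

/-- `[s^m] F^0 = 𝟙[m = 0]`. [cite: Graham2010, Section 3] -/
theorem cpow_zero (f : ℕ → ℝ) (m : ℕ) : cpow f 0 m = if m = 0 then 1 else 0 := by
  rw [cpow]

/-- The recursion `[s^m] F^{a+1} = Σ_{k=0}^{m} [s^k]F^a · f_{m-k}`. [cite: Graham2010, Section 3] -/
theorem cpow_succ (f : ℕ → ℝ) (a m : ℕ) :
    cpow f (a + 1) m = ∑ k ∈ range (m + 1), cpow f a k * f (m - k) := by
  rw [cpow]

/-- `[s^m] F^1 = f_m`. [cite: Graham2010, Section 3] -/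
@[simp] theorem cpow_one (f : ℕ → ℝ) (m : ℕ) : cpow f 1 m = f m := by
  rw [cpow_succ, sum_range_succ']
  have h0 : ∑ k ∈ range m, cpow f 0 (k + 1) * f (m - (k + 1)) = 0 := by
    refine sum_eq_zero fun k _ => ?_
    rw [cpow_zero, if_neg (by omega), zero_mul]
  rw [h0, zero_add, cpow_zero, if_pos rfl, one_mul, Nat.sub_zero]

/-- `[s^0] F^a = f₀^a`. [cite: Graham2010, Section 3] -/
theorem cpow_zero_right (f : ℕ → ℝ) (a : ℕ) : cpow f a 0 = f 0 ^ a := by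
  induction a with
  | zero => rw [cpow_zero, if_pos rfl, pow_zero]
  | succ a ih => rw [cpow_succ, sum_range_one, ih, Nat.sub_zero, pow_succ]

/-- `cpow` is Mathlib's power-series coefficient: `[s^m](Σᵢ fᵢ sⁱ)^a = coeff m ((mk f)^a)`.
[cite: Graham2010, Section 3] -/
theorem cpow_eq_coeff_pow (f : ℕ → ℝ) (a m : ℕ) :
    cpow f a m = PowerSeries.coeff m ((PowerSeries.mk f) ^ a) := by
  induction a generalizing m with
  | zero => rw [cpow_zero, pow_zero, PowerSeries.coeff_one]
  | succ a ih =>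
    rw [cpow_succ, pow_succ, PowerSeries.coeff_mul, Finset.Nat.sum_antidiagonal_eq_sum_range_succ
      (fun i j => PowerSeries.coeff i ((PowerSeries.mk f) ^ a) * PowerSeries.coeff j (PowerSeries.mk f))]
    refine sum_congr rfl fun k _ => ?_
    rw [ih, PowerSeries.coeff_mk]

/-- Locality: `[s^m] F^a` depends only on `f₀, …, f_m`. [cite: Graham2010, Section 3] -/
theorem cpow_congr {f g : ℕ → ℝ} {m : ℕ} (h : ∀ i, i ≤ m → f i = g i) (a : ℕ) :
    ∀ k, k ≤ m → cpow f a k = cpow g a k := by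
  induction a with
  | zero => intro k _; rw [cpow_zero, cpow_zero]
  | succ a ih =>
    intro k hk
    rw [cpow_succ, cpow_succ]
    refine sum_congr rfl fun i hi => ?_
    rw [mem_range] at hi
    rw [ih i (by omega), h (k - i) (by omega)]

/-- Monotonicity / domination: if `|fᵢ| ≤ gᵢ` for `i ≤ m` then `|[s^k] F^a| ≤ [s^k] G^a` for
`k ≤ m`. [cite: Graham2010, Section 4, proof of Lemma 3] -/
theorem abs_cpow_le {f g : ℕ → ℝ} {m : ℕ} (h : ∀ i, i ≤ m → |f i| ≤ g i) (a : ℕ) :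
    ∀ k, k ≤ m → |cpow f a k| ≤ cpow g a k := by
  induction a with
  | zero =>
    intro k _
    rw [cpow_zero, cpow_zero]
    split_ifs <;> simp
  | succ a ih =>
    intro k hk
    rw [cpow_succ, cpow_succ]
    refine (abs_sum_le_sum_abs _ _).trans (sum_le_sum fun i hi => ?_)
    rw [mem_range] at hi
    rw [abs_mul]
    have h1 := ih i (by omega)
    have h2 := h (k - i) (by omega)
    exact mul_le_mul h1 h2 (abs_nonneg _) ((abs_nonneg _).trans h1)

/-- Nonnegative coefficients have nonnegative convolution powers. [folklore] -/
theorem cpow_nonneg {g : ℕ → ℝ} {m : ℕ} (h : ∀ i, i ≤ m → 0 ≤ g i) (a : ℕ) :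
    ∀ k, k ≤ m → 0 ≤ cpow g a k := by
  intro k hk
  have h' : ∀ i, i ≤ m → |g i| ≤ g i := fun i hi => (abs_of_nonneg (h i hi)).le
  exact (abs_nonneg _).trans (abs_cpow_le h' a k hk)

/-- The binomial formula for convolution powers of a series with constant term `1`:
if `f₀ = 1` and `v = f - δ₀` (`v₀ = 0`, `vᵢ = fᵢ` for `i ≥ 1`) then
`[s^m] F^a = Σ_{j=0}^{a} C(a,j) [s^m] V^j`. [folklore] -/
theorem cpow_one_add (f : ℕ → ℝ) (hf : f 0 = 1) (a m : ℕ) :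
    cpow f a m = ∑ j ∈ range (a + 1), (a.choose j : ℝ) * cpow (fun i => if i = 0 then 0 else f i) j m := by
  set v : ℕ → ℝ := fun i => if i = 0 then 0 else f i with hv
  have hsplit : PowerSeries.mk f = PowerSeries.mk v + 1 := by
    ext n
    rw [map_add, PowerSeries.coeff_mk, PowerSeries.coeff_mk, PowerSeries.coeff_one, hv]
    by_cases hn : n = 0
    · simp [hn, hf]
    · simp [hn]
  rw [cpow_eq_coeff_pow, hsplit, add_pow, map_sum]
  refine sum_congr rfl fun j _ => ?_
  rw [one_pow, mul_one, mul_comm, ← map_natCast (PowerSeries.C (R := ℝ)), PowerSeries.coeff_C_mul,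
    cpow_eq_coeff_pow]

/-! ### The factorial toolkit (in place of Lemma 5 / Corollary 6) -/

/-- `n ≤ C(n,k)` for `1 ≤ k ≤ n - 1`. [folklore] -/
theorem le_choose_of_mem {n k : ℕ} (h1 : 1 ≤ k) (h2 : k + 1 ≤ n) : n ≤ n.choose k := by
  induction n generalizing k with
  | zero => omega
  | succ n ih =>
    rcases Nat.eq_or_lt_of_le h1 with rfl | hk1
    · rw [Nat.choose_one_right]
    · -- `2 ≤ k ≤ n`
      obtain ⟨j, rfl⟩ : ∃ j, k = j + 1 := ⟨k - 1, by omega⟩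
      rw [Nat.choose_succ_succ']
      have hA : n ≤ n.choose j := ih (by omega) (by omega)
      have hB : 1 ≤ n.choose (j + 1) := Nat.choose_pos (by omega)
      omega

/-- `i! (m-i)! ≤ (m-1)!` for `1 ≤ i ≤ m-1` (equivalently `m ≤ C(m,i)`): the extreme terms dominate
a convolution of factorials. [folklore] -/
theorem factorial_mul_factorial_le {i m : ℕ} (h1 : 1 ≤ i) (h2 : i + 1 ≤ m) :
    (i.factorial : ℝ) * ((m - i).factorial : ℝ) ≤ ((m - 1).factorial : ℝ) := by
  have hle : i ≤ m := by omega
  have hchoose : m ≤ m.choose i := le_choose_of_mem h1 h2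
  have hnat : m.choose i * i.factorial * (m - i).factorial = m.factorial :=
    Nat.choose_mul_factorial_mul_factorial hle
  have hm : m.factorial = m * (m - 1).factorial := by
    conv_lhs => rw [show m = (m - 1) + 1 by omega, Nat.factorial_succ]
    rw [show m - 1 + 1 = m by omega]
  -- `m · (i!(m-i)!) ≤ C(m,i) · i! (m-i)! = m! = m · (m-1)!`
  have key : m * (i.factorial * (m - i).factorial) ≤ m * (m - 1).factorial := by
    calc m * (i.factorial * (m - i).factorial)
        ≤ m.choose i * (i.factorial * (m - i).factorial) := Nat.mul_le_mul_right _ hchoose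
      _ = m.factorial := by rw [← hnat]; ring
      _ = m * (m - 1).factorial := hm
  have hm0 : 0 < m := by omega
  have key' : i.factorial * (m - i).factorial ≤ (m - 1).factorial := Nat.le_of_mul_le_mul_left key hm0
  exact_mod_cast key'

/-- **Powers of a factorially bounded series without constant term** (the rôle of Lemma 5 /
Corollary 6): if `f₀ = 0` and `0 ≤ f_l ≤ A B^l l!` for `1 ≤ l ≤ M` (`A, B ≥ 0`), then for every
`j ≥ 1` and `m ≤ M`, `0 ≤ [s^m] F^j ≤ A^j B^m m!`. (Graham: "`[β^k] ψ(β)ⁿ ≤ 6^k (k-n)!`" for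
`ψ = Σ_{k≥1} k! β^k`; the present cruder-in-`(k-n)!`, sharper-in-the-constant form is what the
majorant argument below uses.) [cite: Graham2010, Lemma 5 and Corollary 6] -/
theorem cpow_le_of_factorial_bound {f : ℕ → ℝ} {A B : ℝ} {M : ℕ} (hA : 0 ≤ A) (hB : 0 ≤ B)
    (hf0 : f 0 = 0) (hf : ∀ l, 1 ≤ l → l ≤ M → 0 ≤ f l ∧ f l ≤ A * B ^ l * (l.factorial : ℝ)) :
    ∀ j, 1 ≤ j → ∀ m, m ≤ M → cpow f j m ≤ A ^ j * B ^ m * (m.factorial : ℝ) := by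
  have hnn : ∀ i, i ≤ M → 0 ≤ f i := by
    intro i hi
    rcases Nat.eq_zero_or_pos i with rfl | hi0
    · rw [hf0]
    · exact (hf i hi0 hi).1
  intro j hj
  induction j with
  | zero => omega
  | succ j ih =>
    intro m hm
    rcases Nat.eq_zero_or_pos j with rfl | hj1
    · -- `j + 1 = 1`
      rw [zero_add, cpow_one, pow_one]
      rcases Nat.eq_zero_or_pos m with rfl | hm0
      · rw [hf0]; positivity
      · exact (hf m hm0 hm).2
    · have ih' := ih hj1
      rw [cpow_succ]
      rcases Nat.eq_zero_or_pos m with rfl | hm0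
      · -- `m = 0`: the only term is `[s^0]F^j · f₀ = 0`
        rw [sum_range_one, Nat.sub_zero, hf0, mul_zero]; positivity
      · obtain ⟨n, rfl⟩ : ∃ n, m = n + 1 := ⟨m - 1, by omega⟩
        -- peel off `k = n+1` (factor `f₀ = 0`) and `k = 0` (factor `[s^0]F^j = f₀^j = 0`)
        rw [sum_range_succ, Nat.sub_self, hf0, mul_zero, add_zero, sum_range_succ']
        rw [cpow_zero_right, hf0, zero_pow (by omega), zero_mul, add_zero]
        -- middle terms `k = i+1`, `1 ≤ i+1 ≤ n`: each `≤ A^{j+1} B^{n+1} n!`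
        have hterm : ∀ i ∈ range n, cpow f j (i + 1) * f (n + 1 - (i + 1)) ≤
            A ^ (j + 1) * B ^ (n + 1) * (n.factorial : ℝ) := by
          intro i hi
          rw [mem_range] at hi
          have h1 : cpow f j (i + 1) ≤ A ^ j * B ^ (i + 1) * ((i + 1).factorial : ℝ) :=
            ih' (i + 1) (by omega)
          have h1' : 0 ≤ cpow f j (i + 1) := cpow_nonneg hnn j (i + 1) (by omega)
          have h2 := hf (n + 1 - (i + 1)) (by omega) (by omega)
          calc cpow f j (i + 1) * f (n + 1 - (i + 1))
              ≤ (A ^ j * B ^ (i + 1) * ((i + 1).factorial : ℝ)) *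
                  (A * B ^ (n + 1 - (i + 1)) * ((n + 1 - (i + 1)).factorial : ℝ)) :=
                mul_le_mul h1 h2.2 h2.1 (by positivity)
            _ = A ^ (j + 1) * B ^ (n + 1) *
                  (((i + 1).factorial : ℝ) * ((n + 1 - (i + 1)).factorial : ℝ)) := by
                have hBpow : B ^ (i + 1) * B ^ (n + 1 - (i + 1)) = B ^ (n + 1) := by
                  rw [← pow_add]; congr 1; omega
                calc A ^ j * B ^ (i + 1) * ((i + 1).factorial : ℝ) *
                      (A * B ^ (n + 1 - (i + 1)) * ((n + 1 - (i + 1)).factorial : ℝ))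
                    = A ^ j * A * (B ^ (i + 1) * B ^ (n + 1 - (i + 1))) *
                        (((i + 1).factorial : ℝ) * ((n + 1 - (i + 1)).factorial : ℝ)) := by ring
                  _ = _ := by rw [hBpow]; ring
            _ ≤ A ^ (j + 1) * B ^ (n + 1) * (n.factorial : ℝ) := by
                refine mul_le_mul_of_nonneg_left ?_ (by positivity)
                have := factorial_mul_factorial_le (i := i + 1) (m := n + 1) (by omega) (by omega)
                simpa using this
        calc ∑ i ∈ range n, cpow f j (i + 1) * f (n + 1 - (i + 1))
            ≤ ∑ i ∈ range n, A ^ (j + 1) * B ^ (n + 1) * (n.factorial : ℝ) := sum_le_sum hterm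
          _ = n * (A ^ (j + 1) * B ^ (n + 1) * (n.factorial : ℝ)) := by
              rw [sum_const, card_range, nsmul_eq_mul]
          _ ≤ A ^ (j + 1) * B ^ (n + 1) * ((n + 1).factorial : ℝ) := by
              rw [Nat.factorial_succ, Nat.cast_mul]
              have h0 : 0 ≤ A ^ (j + 1) * B ^ (n + 1) * (n.factorial : ℝ) := by positivity
              push_cast
              nlinarith

/-! ### The reversion coefficients `αₙ` (Graham 2010, §3) -/

/-- `[sⁿ] U(s)`, where `β(s) = s·U(s)` is the formal solution of Graham's fixed-point equation
`β = s[1 + Σ_{(a,b)∈I} c_{a,b} β^a s^{b-a}]`, `I = {(a,b) : b ≥ 1, b+1 ≤ a ≤ 2b}`, i.e.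
`U = 1 + Σ_{b≥1} s^b Σ_{a=b+1}^{2b} c_{a,b} U^a`: `U₀ = 1` and, for `n ≥ 1`,
`Uₙ = Σ_{b=1}^{n} Σ_{a=b+1}^{2b} c_{a,b} [s^{n-b}] U^a` (the right-hand side involves `U₀, …, U_{n-1}`
only). The truncation `if i < n+1` makes the well-founded recursion structural; it is removed in
`coefU_succ`. [cite: Graham2010, Section 3 and Lemma 2] -/
def coefU (c : ℕ → ℕ → ℝ) : ℕ → ℝ
  | 0 => 1
  | n + 1 => ∑ b ∈ Icc 1 (n + 1), ∑ a ∈ Icc (b + 1) (2 * b),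
      c a b * cpow (fun i => if i < n + 1 then coefU c i else 0) a (n + 1 - b)

/-- `U₀ = 1`. [cite: Graham2010, Section 3] -/
@[simp] theorem coefU_zero (c : ℕ → ℕ → ℝ) : coefU c 0 = 1 := by
  rw [coefU]

/-- **The triangular recursion** `U_{n+1} = Σ_{b=1}^{n+1} Σ_{a=b+1}^{2b} c_{a,b} [s^{n+1-b}] U^a`
(coefficient of `s^{n+1}` in `U = 1 + Σ_b s^b Σ_a c_{a,b} U^a`). [cite: Graham2010, Section 3] -/
theorem coefU_succ (c : ℕ → ℕ → ℝ) (n : ℕ) :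
    coefU c (n + 1) = ∑ b ∈ Icc 1 (n + 1), ∑ a ∈ Icc (b + 1) (2 * b),
      c a b * cpow (coefU c) a (n + 1 - b) := by
  rw [coefU]
  refine sum_congr rfl fun b hb => sum_congr rfl fun a _ => ?_
  rw [mem_Icc] at hb
  congr 1
  exact cpow_congr (m := n + 1 - b) (fun i hi => by rw [if_pos (by omega)]) a _ le_rfl

/-- **Graham's `αₙ`**: the coefficient of `sⁿ` in the formal expansion `β = Σ_{n≥1} αₙ sⁿ` solving
`β = s[1 + Σ_I c_{a,b} β^a s^{b-a}]`; `αₙ = U_{n-1}` (`β = sU`), and `α₀ = 0`.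
[cite: Graham2010, Section 3 and Lemma 2] -/
def alpha (c : ℕ → ℕ → ℝ) : ℕ → ℝ
  | 0 => 0
  | n + 1 => coefU c n

/-- `α₀ = 0` (the expansion of `β` has no constant term). [cite: Graham2010, Section 3] -/
@[simp] theorem alpha_zero (c : ℕ → ℕ → ℝ) : alpha c 0 = 0 := rfl

/-- `α_{n+1} = Uₙ`. [cite: Graham2010, Section 3] -/
theorem alpha_succ (c : ℕ → ℕ → ℝ) (n : ℕ) : alpha c (n + 1) = coefU c n := rfl

/-- `α₁ = 1` ("Plugging `β_τ = 0` into the right hand side gives `β_τ = s`").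
[cite: Graham2010, Section 3] -/
@[simp] theorem alpha_one (c : ℕ → ℕ → ℝ) : alpha c 1 = 1 := by
  rw [alpha_succ, coefU_zero]

/-- `α₂ = c_{2,1}`. [cite: Graham2010, Section 3] -/
theorem alpha_two (c : ℕ → ℕ → ℝ) : alpha c 2 = c 2 1 := by
  rw [alpha_succ, coefU_succ]
  simp [cpow_zero_right]

/-- `α₃ = 2c_{2,1}² + c_{3,2} + c_{4,2}` — Graham's displayed third coefficient
("`β_τ = s + c_{2,1}s² + (2c_{2,1}² + c_{3,2} + c_{4,2})s³ + …`").
[cite: Graham2010, Section 3] -/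
theorem alpha_three (c : ℕ → ℕ → ℝ) : alpha c 3 = 2 * c 2 1 ^ 2 + c 3 2 + c 4 2 := by
  rw [alpha_succ, coefU_succ]
  have h1 : coefU c 1 = c 2 1 := alpha_two c
  -- `b ∈ {1, 2}`; `b = 1`: `a = 2`, `[s¹]U² = 2U₀U₁`; `b = 2`: `a ∈ {3,4}`, `[s⁰]U^a = 1`
  have hIcc12 : Icc 1 (1 + 1) = {1, 2} := by decide
  have hIcc2 : Icc (1 + 1) (2 * 1) = {2} := by decide
  have hIcc34 : Icc (2 + 1) (2 * 2) = {3, 4} := by decide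
  rw [hIcc12, sum_pair (by norm_num), hIcc2, sum_singleton, hIcc34, sum_pair (by norm_num)]
  simp only [cpow_zero_right, coefU_zero, one_pow, mul_one, show 1 + 1 - 1 = 1 from rfl,
    show 1 + 1 - 2 = 0 from rfl]
  rw [cpow_succ]
  simp [sum_range_succ, h1, cpow_one]
  ring

/-! ### Lemma 3 from Lemma 4 -/

/-- `{1, …, n+1} = {n+1} ∪ {1, …, n}`. [folklore] -/
theorem Icc_one_succ (n : ℕ) : Icc 1 (n + 1) = insert (n + 1) (Icc 1 n) := by
  ext b
  simp only [mem_Icc, mem_insert]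
  omega

/-- `n + 1 ∉ {1, …, n}`. [folklore] -/
theorem succ_notMem_Icc_one (n : ℕ) : n + 1 ∉ Icc 1 n := by
  simp

/-- `Σ_{b=1}^{n} (1/4)^b = (1 - (1/4)ⁿ)/3`. [folklore] -/
theorem sum_Icc_quarter_pow (n : ℕ) :
    ∑ b ∈ Icc 1 n, (1 / 4 : ℝ) ^ b = (1 - (1 / 4 : ℝ) ^ n) / 3 := by
  induction n with
  | zero => simp
  | succ n ih =>
    rw [Icc_one_succ, sum_insert (succ_notMem_Icc_one n), ih, pow_succ]
    ring

/-- The majorant series: `Ũ = coefU |c|` dominates `U` coefficientwise.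
[cite: Graham2010, Section 4, proof of Lemma 3] -/
theorem abs_coefU_le_coefU_abs (c : ℕ → ℕ → ℝ) (n : ℕ) :
    |coefU c n| ≤ coefU (fun a b => |c a b|) n := by
  induction n using Nat.strong_induction_on with
  | _ n ih =>
    rcases n with _ | n
    · simp
    · rw [coefU_succ, coefU_succ]
      refine (abs_sum_le_sum_abs _ _).trans (sum_le_sum fun b hb => ?_)
      rw [mem_Icc] at hb
      refine (abs_sum_le_sum_abs _ _).trans (sum_le_sum fun a _ => ?_)
      rw [abs_mul]
      refine mul_le_mul_of_nonneg_left ?_ (abs_nonneg _)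
      exact abs_cpow_le (m := n + 1 - b) (fun i hi => ih i (by omega)) a _ le_rfl

/-- The majorant series has nonnegative coefficients. [cite: Graham2010, Section 4, proof of Lemma 3] -/
theorem coefU_abs_nonneg (c : ℕ → ℕ → ℝ) (n : ℕ) : 0 ≤ coefU (fun a b => |c a b|) n :=
  (abs_nonneg _).trans (abs_coefU_le_coefU_abs c n)

/-- **The majorant bound.** If `Σ_{a=b+1}^{2b} |c_{a,b}| ≤ C^b b!` for all `b ≥ 1` (the conclusion of
Lemma 4) then the majorant coefficients satisfy `ũₙ ≤ Bⁿ n!` with `B = max 1 (16C)`.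
[cite: Graham2010, Lemma 3 and Lemma 4] -/
theorem coefU_abs_le {c : ℕ → ℕ → ℝ} {C : ℝ} (hC : 0 ≤ C)
    (hc : ∀ b : ℕ, 1 ≤ b → ∑ a ∈ Icc (b + 1) (2 * b), |c a b| ≤ C ^ b * (b.factorial : ℝ))
    (n : ℕ) : coefU (fun a b => |c a b|) n ≤ (max 1 (16 * C)) ^ n * (n.factorial : ℝ) := by
  set B : ℝ := max 1 (16 * C) with hBdef
  set u : ℕ → ℝ := coefU (fun a b => |c a b|) with hu
  have hB1 : 1 ≤ B := le_max_left _ _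
  have hB0 : 0 ≤ B := zero_le_one.trans hB1
  have hCB : 16 * C ≤ B := le_max_right _ _
  have hu0 : ∀ i, 0 ≤ u i := coefU_abs_nonneg c
  induction n using Nat.strong_induction_on with
  | _ n ih =>
    rcases n with _ | n
    · simp [hu]
    -- the series `V = Ũ - 1` and the factorial bound for its powers up to order `n`
    set v : ℕ → ℝ := fun i => if i = 0 then 0 else u i with hv
    have hv0 : v 0 = 0 := by simp [hv]
    have hvb : ∀ l, 1 ≤ l → l ≤ n → 0 ≤ v l ∧ v l ≤ 1 * B ^ l * (l.factorial : ℝ) := by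
      intro l hl1 hln
      have : v l = u l := by rw [hv]; simp [show l ≠ 0 by omega]
      rw [this, one_mul]
      exact ⟨hu0 l, ih l (by omega)⟩
    have hV : ∀ j, 1 ≤ j → ∀ m, m ≤ n → cpow v j m ≤ B ^ m * (m.factorial : ℝ) := by
      intro j hj m hm
      have := cpow_le_of_factorial_bound zero_le_one hB0 hv0 hvb j hj m hm
      simpa using this
    have hVnn : ∀ j m, m ≤ n → 0 ≤ cpow v j m := fun j m hm =>
      cpow_nonneg (m := n) (fun i hi => by
        rcases Nat.eq_zero_or_pos i with rfl | hi0
        · rw [hv0]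
        · exact (hvb i hi0 hi).1) j m hm
    -- bound on `[s^m] Ũ^a` for `1 ≤ m ≤ n`, `a ≤ 2b`: `≤ 4^b B^m m!`
    have hUpow : ∀ b a m, a ≤ 2 * b → 1 ≤ m → m ≤ n →
        cpow u a m ≤ (4 : ℝ) ^ b * (B ^ m * (m.factorial : ℝ)) := by
      intro b a m hab hm1 hmn
      have hu1 : u 0 = 1 := by simp [hu]
      rw [cpow_one_add u hu1 a m, sum_range_succ']
      -- `j = 0` term vanishes for `m ≥ 1`
      rw [cpow_zero, if_neg (by omega), mul_zero, add_zero]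
      calc ∑ j ∈ range a, ((a.choose (j + 1) : ℕ) : ℝ) * cpow v (j + 1) m
          ≤ ∑ j ∈ range a, ((a.choose (j + 1) : ℕ) : ℝ) * (B ^ m * (m.factorial : ℝ)) :=
            sum_le_sum fun j _ => mul_le_mul_of_nonneg_left (hV (j + 1) (by omega) m hmn)
              (Nat.cast_nonneg _)
        _ = (∑ j ∈ range a, ((a.choose (j + 1) : ℕ) : ℝ)) * (B ^ m * (m.factorial : ℝ)) := by
            rw [sum_mul]
        _ ≤ (4 : ℝ) ^ b * (B ^ m * (m.factorial : ℝ)) := by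
            refine mul_le_mul_of_nonneg_right ?_ (by positivity)
            have hsum : ∑ j ∈ range a, ((a.choose (j + 1) : ℕ) : ℝ) ≤ (2 : ℝ) ^ a := by
              have h2 : ∑ j ∈ range (a + 1), ((a.choose j : ℕ) : ℝ) = (2 : ℝ) ^ a := by
                exact_mod_cast Nat.sum_range_choose a
              rw [← h2, sum_range_succ' (fun j => ((a.choose j : ℕ) : ℝ))]
              simp
            calc ∑ j ∈ range a, ((a.choose (j + 1) : ℕ) : ℝ) ≤ (2 : ℝ) ^ a := hsum
              _ ≤ (2 : ℝ) ^ (2 * b) := pow_le_pow_right₀ (by norm_num) hab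
              _ = (4 : ℝ) ^ b := by rw [pow_mul]; norm_num
    -- the recursion for `ũ_{n+1}`, term by term
    rw [show u (n + 1) = coefU (fun a b => |c a b|) (n + 1) from rfl, coefU_succ]
    -- split off `b = n+1`
    rw [Icc_one_succ, sum_insert (succ_notMem_Icc_one n)]
    have hlast : ∑ a ∈ Icc (n + 1 + 1) (2 * (n + 1)),
        |c a (n + 1)| * cpow u a (n + 1 - (n + 1)) ≤ C ^ (n + 1) * ((n + 1).factorial : ℝ) := by
      have : ∀ a ∈ Icc (n + 1 + 1) (2 * (n + 1)), |c a (n + 1)| * cpow u a (n + 1 - (n + 1)) =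
          |c a (n + 1)| := by
        intro a _
        rw [Nat.sub_self, show cpow u a 0 = cpow (coefU fun a b => |c a b|) a 0 from rfl,
          cpow_zero_right, coefU_zero, one_pow, mul_one]
      rw [sum_congr rfl this]
      exact hc (n + 1) (by omega)
    have hrest : ∑ b ∈ Icc 1 n, ∑ a ∈ Icc (b + 1) (2 * b), |c a b| * cpow u a (n + 1 - b) ≤
        ∑ b ∈ Icc 1 n, (1 / 4 : ℝ) ^ b * (B ^ (n + 1) * (n.factorial : ℝ)) := by
      refine sum_le_sum fun b hb => ?_
      rw [mem_Icc] at hb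
      calc ∑ a ∈ Icc (b + 1) (2 * b), |c a b| * cpow u a (n + 1 - b)
          ≤ ∑ a ∈ Icc (b + 1) (2 * b), |c a b| *
              ((4 : ℝ) ^ b * (B ^ (n + 1 - b) * ((n + 1 - b).factorial : ℝ))) := by
            refine sum_le_sum fun a ha => ?_
            rw [mem_Icc] at ha
            exact mul_le_mul_of_nonneg_left (hUpow b a (n + 1 - b) ha.2 (by omega) (by omega))
              (abs_nonneg _)
        _ = (∑ a ∈ Icc (b + 1) (2 * b), |c a b|) *
              ((4 : ℝ) ^ b * (B ^ (n + 1 - b) * ((n + 1 - b).factorial : ℝ))) := by rw [sum_mul]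
        _ ≤ (C ^ b * (b.factorial : ℝ)) *
              ((4 : ℝ) ^ b * (B ^ (n + 1 - b) * ((n + 1 - b).factorial : ℝ))) :=
            mul_le_mul_of_nonneg_right (hc b hb.1) (by positivity)
        _ = (4 * C) ^ b * B ^ (n + 1 - b) * ((b.factorial : ℝ) * ((n + 1 - b).factorial : ℝ)) := by
            rw [mul_pow]; ring
        _ ≤ (4 * C) ^ b * B ^ (n + 1 - b) * (n.factorial : ℝ) := by
            refine mul_le_mul_of_nonneg_left ?_ (by positivity)
            have := factorial_mul_factorial_le (i := b) (m := n + 1) hb.1 (by omega)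
            simpa using this
        _ ≤ (1 / 4 : ℝ) ^ b * (B ^ (n + 1) * (n.factorial : ℝ)) := by
            -- `(4C)^b B^{n+1-b} ≤ (B/4)^b B^{n+1-b} = (1/4)^b B^{n+1}`
            have h1 : (4 * C) ^ b ≤ (B / 4) ^ b :=
              pow_le_pow_left₀ (by positivity) (by linarith) b
            have h2 : (B / 4) ^ b * B ^ (n + 1 - b) = (1 / 4 : ℝ) ^ b * B ^ (n + 1) := by
              have hpow : B ^ (n + 1) = B ^ b * B ^ (n + 1 - b) := by
                rw [← pow_add]; congr 1; omega
              rw [hpow, div_pow, div_pow, one_pow]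
              ring
            calc (4 * C) ^ b * B ^ (n + 1 - b) * (n.factorial : ℝ)
                ≤ (B / 4) ^ b * B ^ (n + 1 - b) * (n.factorial : ℝ) := by
                  gcongr
              _ = (1 / 4 : ℝ) ^ b * (B ^ (n + 1) * (n.factorial : ℝ)) := by rw [h2, mul_assoc]
    have hgeom : ∑ b ∈ Icc 1 n, (1 / 4 : ℝ) ^ b * (B ^ (n + 1) * (n.factorial : ℝ)) ≤
        (1 / 3 : ℝ) * (B ^ (n + 1) * (n.factorial : ℝ)) := by
      rw [← sum_mul, sum_Icc_quarter_pow]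
      refine mul_le_mul_of_nonneg_right ?_ (by positivity)
      have : 0 ≤ (1 / 4 : ℝ) ^ n := by positivity
      linarith
    have hCpow : C ^ (n + 1) * ((n + 1).factorial : ℝ) ≤ (1 / 16 : ℝ) * (B ^ (n + 1) * ((n + 1).factorial : ℝ)) := by
      have h1 : C ^ (n + 1) ≤ (B / 16) ^ (n + 1) := pow_le_pow_left₀ hC (by linarith) _
      have h2 : (B / 16) ^ (n + 1) ≤ (1 / 16 : ℝ) * B ^ (n + 1) := by
        rw [div_pow, pow_succ (16 : ℝ)]
        have h16 : (1 : ℝ) ≤ 16 ^ n := one_le_pow₀ (by norm_num)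
        rw [div_le_iff₀ (by positivity)]
        have hBp : 0 ≤ B ^ (n + 1) := by positivity
        nlinarith
      calc C ^ (n + 1) * ((n + 1).factorial : ℝ) ≤ (B / 16) ^ (n + 1) * ((n + 1).factorial : ℝ) := by
            gcongr
        _ ≤ (1 / 16 : ℝ) * B ^ (n + 1) * ((n + 1).factorial : ℝ) := by gcongr
        _ = _ := by ring
    -- assemble: `ũ_{n+1} ≤ (1/16) B^{n+1}(n+1)! + (1/3) B^{n+1} n! ≤ B^{n+1} (n+1)!`
    have hfac : (n.factorial : ℝ) ≤ ((n + 1).factorial : ℝ) := by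
      exact_mod_cast Nat.factorial_le (Nat.le_succ n)
    have hpos : 0 ≤ B ^ (n + 1) * (n.factorial : ℝ) := by positivity
    have hpos' : 0 ≤ B ^ (n + 1) * ((n + 1).factorial : ℝ) := by positivity
    calc ∑ a ∈ Icc (n + 1 + 1) (2 * (n + 1)), |c a (n + 1)| * cpow u a (n + 1 - (n + 1)) +
          ∑ b ∈ Icc 1 n, ∑ a ∈ Icc (b + 1) (2 * b), |c a b| * cpow u a (n + 1 - b)
        ≤ (1 / 16 : ℝ) * (B ^ (n + 1) * ((n + 1).factorial : ℝ)) +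
            (1 / 3 : ℝ) * (B ^ (n + 1) * (n.factorial : ℝ)) :=
          add_le_add (hlast.trans hCpow) (hrest.trans hgeom)
      _ ≤ B ^ (n + 1) * ((n + 1).factorial : ℝ) := by
          nlinarith [mul_le_mul_of_nonneg_left hfac (by positivity : (0 : ℝ) ≤ B ^ (n + 1))]

/-- **Graham 2010, Lemma 3 from Lemma 4** (explicit constant): if `Σ_{a=b+1}^{2b} |c_{a,b}| ≤ C^b b!`
for every `b ≥ 1`, then `|αₙ| ≤ (max 1 (16C))ⁿ n!` for every `n`. [cite: Graham2010, Lemma 3] -/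
theorem abs_alpha_le_of_lemma4 {c : ℕ → ℕ → ℝ} {C : ℝ} (hC : 0 ≤ C)
    (hc : ∀ b : ℕ, 1 ≤ b → ∑ a ∈ Icc (b + 1) (2 * b), |c a b| ≤ C ^ b * (b.factorial : ℝ))
    (n : ℕ) : |alpha c n| ≤ (max 1 (16 * C)) ^ n * (n.factorial : ℝ) := by
  rcases n with _ | n
  · simp
  · rw [alpha_succ]
    have hB1 : (1 : ℝ) ≤ max 1 (16 * C) := le_max_left _ _
    calc |coefU c n| ≤ coefU (fun a b => |c a b|) n := abs_coefU_le_coefU_abs c n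
      _ ≤ (max 1 (16 * C)) ^ n * (n.factorial : ℝ) := coefU_abs_le hC hc n
      _ ≤ (max 1 (16 * C)) ^ (n + 1) * ((n + 1).factorial : ℝ) := by
          have h1 : (max 1 (16 * C)) ^ n ≤ (max 1 (16 * C)) ^ (n + 1) :=
            pow_le_pow_right₀ hB1 (Nat.le_succ n)
          have h2 : (n.factorial : ℝ) ≤ ((n + 1).factorial : ℝ) := by
            exact_mod_cast Nat.factorial_le (Nat.le_succ n)
          exact mul_le_mul h1 h2 (by positivity) (by positivity)

/-- **Graham 2010, Lemma 3** ("There is a constant `C₂` such that for all `n`, `|αₙ| ≤ C₂ⁿ n!`"),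
in the form "Lemma 4 ⟹ Lemma 3" for arbitrary coefficients `c_{a,b}`: the hypothesis is the
conclusion `c_b = Σ_{a=b+1}^{2b} |c_{a,b}| ≤ C₃^b b!` of Lemma 4. [cite: Graham2010, Lemma 3] -/
theorem lemma3_of_lemma4 {c : ℕ → ℕ → ℝ}
    (h4 : ∃ C₃ : ℝ, ∀ b : ℕ, 1 ≤ b → ∑ a ∈ Icc (b + 1) (2 * b), |c a b| ≤ C₃ ^ b * (b.factorial : ℝ)) :
    ∃ C₂ : ℝ, 0 < C₂ ∧ ∀ n : ℕ, |alpha c n| ≤ C₂ ^ n * (n.factorial : ℝ) := by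
  obtain ⟨C₃, hC₃⟩ := h4
  -- `C₃ ≥ 0` is forced by the case `b = 1`: `0 ≤ Σ_{a=2}^{2} |c_{a,1}| ≤ C₃ · 1!`
  have hC₃0 : 0 ≤ C₃ := by
    have h := hC₃ 1 le_rfl
    have h0 : (0 : ℝ) ≤ ∑ a ∈ Icc (1 + 1) (2 * 1), |c a 1| := sum_nonneg fun _ _ => abs_nonneg _
    simpa using h0.trans h
  exact ⟨max 1 (16 * C₃), lt_of_lt_of_le one_pos (le_max_left _ _),
    abs_alpha_le_of_lemma4 hC₃0 hC₃⟩

end Literature.Probability.RandomPlanarGeometry.SAW.Zd.Graham2010
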